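import Summits.AtomisticToContinuum.HydrodynamicLimit.Theorems.StiffCollisionalRelaxationAprioriBoundsFibreDefsR4
import Summits.AtomisticToContinuum.HydrodynamicLimit.Theorems.StiffCollisionalRelaxationAprioriBoundsFibreDeficitSliceGibbs
import Summits.AtomisticToContinuum.HydrodynamicLimit.Theorems.StiffCollisionalRelaxationAprioriBoundsFibreDeficitSlabBounds
import Summits.AtomisticToContinuum.HydrodynamicLimit.Theorems.StiffCollisionalRelaxationAprioriBoundsPartOneChain
import Summits.AtomisticToContinuum.HydrodynamicLimit.Theorems.StiffCollisionalRelaxationAprioriBoundsFibreLinStatL1Glue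
import HarnessLib

/-!
# Rate-free relative-entropy budget from statics + hydrodynamics in the mean (line `fibre-deficit-transfer`, skeleton r4 glue)
(crux `AprioriBounds`, stmt-AtomisticToContinuum-14827)

Support file (`--supports stmt-AtomisticToContinuum-14827`) of the lead prover of the line.  The identity of the line (part 1,
`toReal_klDiv_lawAt_slice_eq`): `H(μ_s | G_s) = [log Z_N(Λ_s) − S(μ₀) − (N+1)m_s] − (N+1)E_{μ₀}[ℓ_s ∘ Φ_s]`, `G_s` the local Gibbs law of
the slice activity.  Hence `H(μ_s | G_s) ≤ |bracket_s| + (N+1)·E|ℓ_s ∘ Φ_s|`, and integrating in `s` (the mean `E|ℓ_s ∘ Φ_s|` is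
a.e.-measurable in `s` by the joint measurability of the flow on its good set, landed as
`LinStatL1.aemeasurable_lintegral_abs_linStat_flow'` in `…FibreLinStatL1Glue`):

  `BracketIntegratedVanishAt ∧ LinStatL1VanishAt ⟹ KLIntegratedVanishAt … (sliceAct …)`   (`klIntegratedVanish_of_bracket_linStat`,
  registered sub-goal) — rate-free statics + isentropy and hydrodynamics in the mean give time-integrated relative-entropy closeness `o(N)`,
  the input of the rate-free lever `integratedBulkTail_of_klDiv_integrated`.
-/

noncomputable section

open MeasureTheory Filter Set Topology InformationTheory
open scoped ENNReal

namespace Summit.AtomisticToContinuum.HydrodynamicLimit.Theorems.FibreDeficitTransfer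

open Literature.MathematicalPhysics.KineticTheory Literature.Analysis.FluidPDE
open Summit.AtomisticToContinuum.HydrodynamicLimit.Theorems.VisitLedgerUpscattering (Cfg Flow Flows NiceProfiles)
open JaynesSqueezeClosure

/-- **Rate-free relative-entropy budget** (registered sub-goal `klIntegratedVanish_of_bracket_linStat`): for `0 < σ < 1/2`, nice profiles,
`t > 0`, fields jointly continuous on `[0,t] × 𝕋³` with `θ > 0` and a jointly continuous density multiplier,
`BracketIntegratedVanishAt ∧ LinStatL1VanishAt ⟹ KLIntegratedVanishAt … (sliceAct …)`. -/
theorem klIntegratedVanish_of_bracket_linStat : ∀ (σ : ℝ) (a₀ θ₀ : T3 → ℝ) (u₀ : T3 → V3) (ρ θ : ℝ → T3 → ℝ) (u : ℝ → T3 → V3) (Φ : (N : ℕ) → HardSphereFlow (Torus.geometry (Fin 3)) (hsDiameter σ N) (N + 1)) (t : ℝ), 0 < σ → σ < 1 / 2 → NiceProfiles a₀ θ₀ u₀ → 0 < t → ContinuousOn (Function.uncurry ρ) (Icc 0 t ×ˢ univ) → ContinuousOn (Function.uncurry θ) (Icc 0 t ×ˢ univ) → ContinuousOn (Function.uncurry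 u) (Icc 0 t ×ˢ univ) → (∀ s ∈ Icc 0 t, ∀ x, 0 < θ s x) → ContinuousOn (fun p : ℝ × T3 => lam0 σ (ρ p.1 p.2) (θ p.1 p.2) (u p.1 p.2)) (Icc 0 t ×ˢ univ) → BracketIntegratedVanishAt σ a₀ θ₀ u₀ ρ θ u t → LinStatL1VanishAt σ a₀ θ₀ u₀ ρ θ u Φ t → KLIntegratedVanishAt σ a₀ θ₀ u₀ (sliceAct σ ρ θ u) θ u Φ t := by
  intro σ a₀ θ₀ u₀ ρ θ u Φ t hσ hσ2 hP ht hρc hθc huc hθ hΛ hB hL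
  obtain ⟨ha, hθ₀, hu₀, ha0, hθ0⟩ := hP
  have hσ2' : σ ≤ 1 / 2 := hσ2.le
  -- pointwise budget for every `N`: `∫ klDiv ≤ ∫ ofReal|bracket| + (N+1) ∫ E|ℓ ∘ Φ|`
  have hbudget : ∀ N : ℕ, (∫⁻ s in Icc 0 t, klDiv ((Φ N).lawAt (localGibbsLaw σ a₀ u₀ θ₀ N (Φ N)) s)
      (localGibbsLaw σ (sliceAct σ ρ θ u s) (u s) (θ s) N (Φ N))) / ((N : ℝ≥0∞) + 1) ≤
      (∫⁻ s in Icc 0 t, ENNReal.ofReal (((N : ℝ) + 1)⁻¹ *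
        |Real.log (tiltZ σ ρ θ u N s).toReal - gibbsEntropy σ a₀ u₀ θ₀ N - ((N : ℝ) + 1) * tiltMean σ ρ θ u s|)) +
      ∫⁻ s in Icc 0 t, ∫⁻ z, ENNReal.ofReal |linStat σ ρ θ u s ((Φ N).flow s z)| ∂(localGibbsLaw σ a₀ u₀ θ₀ N (Φ N)) := by
    intro N
    haveI := isProbabilityMeasure_localGibbsLaw ha hθ₀ hu₀ ha0 hθ0 hσ2' N (Φ N)
    have hEpos : (0 : ℝ) < (N : ℝ) + 1 := by positivity
    have hN0 : ((N : ℝ≥0∞) + 1) ≠ 0 := by simp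
    have hNtop : ((N : ℝ≥0∞) + 1) ≠ ⊤ := by simp
    have hcast : ((N : ℝ≥0∞) + 1) = ENNReal.ofReal ((N : ℝ) + 1) := by
      rw [ENNReal.ofReal_add (Nat.cast_nonneg N) zero_le_one, ENNReal.ofReal_natCast, ENNReal.ofReal_one]
    -- pointwise in `s`
    have hpt : ∀ s ∈ Icc 0 t, klDiv ((Φ N).lawAt (localGibbsLaw σ a₀ u₀ θ₀ N (Φ N)) s)
        (localGibbsLaw σ (sliceAct σ ρ θ u s) (u s) (θ s) N (Φ N)) ≤
        ENNReal.ofReal |Real.log (tiltZ σ ρ θ u N s).toReal - gibbsEntropy σ a₀ u₀ θ₀ N - ((N : ℝ) + 1) * tiltMean σ ρ θ u s| +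
          ((N : ℝ≥0∞) + 1) * ∫⁻ z, ENNReal.ofReal |linStat σ ρ θ u s ((Φ N).flow s z)| ∂(localGibbsLaw σ a₀ u₀ θ₀ N (Φ N)) := by
      intro s hs
      have hθs : Continuous (θ s) := continuous_slice hθc hs
      have hus : Continuous (u s) := continuous_slice huc hs
      have hθpos : ∀ x, 0 < θ s x := hθ s hs
      have hΛs : Continuous fun x => lam0 σ (ρ s x) (θ s x) (u s x) :=
        continuous_slice (f := fun s x => lam0 σ (ρ s x) (θ s x) (u s x)) hΛ hs
      have hbc : Continuous (sliceAct σ ρ θ u s) := continuous_sliceAct s hθs hus hθpos hΛs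
      have hbpos : ∀ x, 0 < sliceAct σ ρ θ u s x := fun x => sliceAct_pos s x (hθpos x)
      have hkl : klDiv ((Φ N).lawAt (localGibbsLaw σ a₀ u₀ θ₀ N (Φ N)) s)
          (localGibbsLaw σ (sliceAct σ ρ θ u s) (u s) (θ s) N (Φ N)) ≠ ⊤ :=
        klDiv_lawAt_localGibbsLaw_ne_top hσ2' ha hθ₀ hu₀ ha0 hθ0 hbc hθs hus hbpos hθpos N (Φ N) s
      have hid := toReal_klDiv_lawAt_slice_eq ha hθ₀ hu₀ ha0 hθ0 hσ hσ2 N (Φ N) s hθs hus hθpos hΛs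
      have hint := integrable_linStat_flow ha hθ₀ hu₀ ha0 hθ0 hσ2' N (Φ N) s hθs hus hθpos hΛs
      have habs : ∫ z, |linStat σ ρ θ u s ((Φ N).flow s z)| ∂(localGibbsLaw σ a₀ u₀ θ₀ N (Φ N)) =
          (∫⁻ z, ENNReal.ofReal |linStat σ ρ θ u s ((Φ N).flow s z)| ∂(localGibbsLaw σ a₀ u₀ θ₀ N (Φ N))).toReal := by
        rw [integral_eq_lintegral_of_nonneg_ae (ae_of_all _ fun z => abs_nonneg _) hint.abs.aestronglyMeasurable]
      have hfin : (∫⁻ z, ENNReal.ofReal |linStat σ ρ θ u s ((Φ N).flow s z)| ∂(localGibbsLaw σ a₀ u₀ θ₀ N (Φ N))) ≠ ⊤ :=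
        (hint.abs.lintegral_lt_top).ne
      have hid' : (klDiv ((Φ N).lawAt (localGibbsLaw σ a₀ u₀ θ₀ N (Φ N)) s)
          (localGibbsLaw σ (sliceAct σ ρ θ u s) (u s) (θ s) N (Φ N))).toReal =
          Real.log (tiltZ σ ρ θ u N s).toReal - gibbsEntropy σ a₀ u₀ θ₀ N - ((N : ℝ) + 1) * tiltMean σ ρ θ u s -
            ((N : ℝ) + 1) * ∫ z, linStat σ ρ θ u s ((Φ N).flow s z) ∂(localGibbsLaw σ a₀ u₀ θ₀ N (Φ N)) := hid
      have hle : -(∫ z, linStat σ ρ θ u s ((Φ N).flow s z) ∂(localGibbsLaw σ a₀ u₀ θ₀ N (Φ N))) ≤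
          ∫ z, |linStat σ ρ θ u s ((Φ N).flow s z)| ∂(localGibbsLaw σ a₀ u₀ θ₀ N (Φ N)) := by
        rw [← integral_neg]
        exact integral_mono hint.neg hint.abs fun z => neg_le_abs _
      rw [← ENNReal.ofReal_toReal hkl, hid', hcast, ← ENNReal.ofReal_toReal hfin, ← ENNReal.ofReal_mul hEpos.le,
        ← ENNReal.ofReal_add (abs_nonneg _) (mul_nonneg hEpos.le ENNReal.toReal_nonneg)]
      refine ENNReal.ofReal_le_ofReal ?_
      rw [← habs]
      have h1 := le_abs_self (Real.log (tiltZ σ ρ θ u N s).toReal - gibbsEntropy σ a₀ u₀ θ₀ N - ((N : ℝ) + 1) * tiltMean σ ρ θ u s)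
      nlinarith [hle, hEpos]
    -- integrate (the second summand is a.e.-measurable in `s`)
    have hgm : AEMeasurable (fun s => ((N : ℝ≥0∞) + 1) *
        ∫⁻ z, ENNReal.ofReal |linStat σ ρ θ u s ((Φ N).flow s z)| ∂(localGibbsLaw σ a₀ u₀ θ₀ N (Φ N))) (volume.restrict (Icc 0 t)) :=
      (LinStatL1.aemeasurable_lintegral_abs_linStat_flow' ⟨ha, hθ₀, hu₀, ha0, hθ0⟩ hσ2' hρc hθc huc ht.le hθ hΛ N (Φ N)).const_mul _
    calc (∫⁻ s in Icc 0 t, klDiv ((Φ N).lawAt (localGibbsLaw σ a₀ u₀ θ₀ N (Φ N)) s)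
          (localGibbsLaw σ (sliceAct σ ρ θ u s) (u s) (θ s) N (Φ N))) / ((N : ℝ≥0∞) + 1)
        ≤ (∫⁻ s in Icc 0 t, (ENNReal.ofReal |Real.log (tiltZ σ ρ θ u N s).toReal - gibbsEntropy σ a₀ u₀ θ₀ N -
            ((N : ℝ) + 1) * tiltMean σ ρ θ u s| +
            ((N : ℝ≥0∞) + 1) * ∫⁻ z, ENNReal.ofReal |linStat σ ρ θ u s ((Φ N).flow s z)| ∂(localGibbsLaw σ a₀ u₀ θ₀ N (Φ N)))) /
            ((N : ℝ≥0∞) + 1) :=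
          ENNReal.div_le_div_right (setLIntegral_mono' measurableSet_Icc fun s hs => hpt s hs) _
      _ = (∫⁻ s in Icc 0 t, ENNReal.ofReal |Real.log (tiltZ σ ρ θ u N s).toReal - gibbsEntropy σ a₀ u₀ θ₀ N -
            ((N : ℝ) + 1) * tiltMean σ ρ θ u s|) / ((N : ℝ≥0∞) + 1) +
          ∫⁻ s in Icc 0 t, ∫⁻ z, ENNReal.ofReal |linStat σ ρ θ u s ((Φ N).flow s z)| ∂(localGibbsLaw σ a₀ u₀ θ₀ N (Φ N)) := by
          rw [lintegral_add_right' _ hgm, ENNReal.add_div, lintegral_const_mul'' _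
            (LinStatL1.aemeasurable_lintegral_abs_linStat_flow' ⟨ha, hθ₀, hu₀, ha0, hθ0⟩ hσ2' hρc hθc huc ht.le hθ hΛ N (Φ N)), mul_comm,
            ENNReal.mul_div_cancel_right hN0 hNtop]
      _ = _ := by
          congr 1
          rw [div_eq_mul_inv, ← lintegral_mul_const' _ _ (ENNReal.inv_ne_top.2 hN0)]
          refine lintegral_congr fun s => ?_
          rw [hcast, ← ENNReal.ofReal_inv_of_pos hEpos, ← ENNReal.ofReal_mul (abs_nonneg _), mul_comm]
  -- squeeze
  have hsum : Tendsto (fun N : ℕ => (∫⁻ s in Icc 0 t, ENNReal.ofReal (((N : ℝ) + 1)⁻¹ *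
        |Real.log (tiltZ σ ρ θ u N s).toReal - gibbsEntropy σ a₀ u₀ θ₀ N - ((N : ℝ) + 1) * tiltMean σ ρ θ u s|)) +
      ∫⁻ s in Icc 0 t, ∫⁻ z, ENNReal.ofReal |linStat σ ρ θ u s ((Φ N).flow s z)| ∂(localGibbsLaw σ a₀ u₀ θ₀ N (Φ N)))
      atTop (𝓝 0) := by
    have h := hB.add hL
    rwa [add_zero] at h
  exact tendsto_of_tendsto_of_tendsto_of_le_of_le tendsto_const_nhds hsum (fun N => bot_le) hbudget

end Summit.AtomisticToContinuum.HydrodynamicLimit.Theorems.FibreDeficitTransfer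

end
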